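import Mathlib.Analysis.InnerProductSpace.PiL2
import Mathlib.Analysis.Normed.Operator.LinearIsometry
import Mathlib.Order.Filter.AtTopBot.Basic
import Literature.MathematicalPhysics.StatisticalMechanics.BarlowStacking
import Literature.MathematicalPhysics.StatisticalMechanics.HaggStacking

/-!
# Crux `BarlowLiouville` (stmt-AtomisticToContinuum-15801), line `Sketch` — stub 3 `stub_transfer`

Stub `stub_transfer` of the lead skeleton `DisclinationRationBarlowLiouville` (pure bookkeeping):
patches of a hull element are windows of the sequence.  Let `x N` (`N : ℕ`) be finite
configurations in `ℝ³` and let `X ⊆ ℝ³` be a HULL ELEMENT of `x`: along a strictly increasing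
`φ : ℕ → ℕ` with translations `τ j`, the translates `x (φ j) · + τ j` are two-way `ε`-matched with
`X` on the ball `‖·‖ ≤ R`, eventually in `j`, for every `(R, ε)`.  Suppose `X` has near-layered
patches at every scale with ONE in-layer spacing `a ∈ [47/50, 1]`: for every `(R, η)` some translate
`X + t` is two-way `η`-matched on `‖·‖ ≤ R` with a rigid image `S = A · L(a, s, z)` of a relaxed
layered set (triangular layers of spacing `a` in hollow registry, Hagg word `s`, heights `z` with
gaps in `[39/50 a, 17/20 a]`).  Then `x` has layered windows at every scale with the same `a`,
frequently in `N`.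

Proof: fix `(R, ε)` and `M`.  Take the patch data `(A, t, s, z)` at radius `R + ε/2` and tolerance
`ε/2`, then the hull matching at radius `R + ‖t‖ + ε/2` and tolerance `ε/2` at some index `j ≥ M`
(`Filter.eventually_ge_atTop`, `Filter.Eventually.exists`); put `N = φ j ≥ j ≥ M`
(`StrictMono.id_le`), keep `(A, s, z)` and translate by `τ j + t`.  Both matching clauses follow from
two triangle inequalities through the intermediate point of `X` (translation invariance
`dist (u + t) (v + t) = dist u v`); the radii are related by `‖q‖ ≤ ‖q + t‖ + ‖t‖` and
`‖u‖ ≤ ‖p‖ + dist u p` (`norm_le_norm_add_norm_sub'`).  Pattern of the landed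
`PeriodicWindowsDenseLaminarHull.stub_windowsOfTemplateHullPoint`.
-/

noncomputable section

namespace Summit.AtomisticToContinuum.Crystallization.Theorems.DisclinationRationBarlowLiouville

open Literature.MathematicalPhysics.StatisticalMechanics Filter

/-- Euclidean `3`-space. -/
local notation "E3" => EuclideanSpace ℝ (Fin 3)

/-- Undo a translation in a norm bound: `‖q‖ ≤ ‖q + t‖ + ‖t‖`. -/
theorem tr_norm_le_norm_add_add_norm (q t : E3) : ‖q‖ ≤ ‖q + t‖ + ‖t‖ :=
  calc ‖q‖ = ‖q + t - t‖ := by rw [add_sub_cancel_right]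
    _ ≤ ‖q + t‖ + ‖t‖ := norm_sub_le _ _

/-- Translation invariance of the distance, in the associativity pattern of the composed
translation `τ j + t`: `dist (u + (v + t)) (w + t) = dist (u + v) w`. -/
theorem tr_dist_add_add (u v t w : E3) : dist (u + (v + t)) (w + t) = dist (u + v) w := by
  rw [← add_assoc, dist_add_right]

/-- STUB 3 (M) — patches of a hull element are windows of the sequence: if `X` is a hull element of `x`
(translates of a subsequence two-way matched with `X` on every ball, eventually) and `X` has near-layered
patches at every scale with one spacing `a`, then `x` has layered windows at every scale with that `a`,
frequently in `N` (compose the translations, two triangle inequalities, `StrictMono φ`). -/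
theorem stub_transfer : ∀ x : (N : ℕ) → (Fin N → E3), ∀ X : Set E3,
    (∃ φ : ℕ → ℕ, StrictMono φ ∧ ∃ τ : ℕ → E3, ∀ R ε : ℝ, 0 < ε → ∀ᶠ j : ℕ in Filter.atTop,
      (∀ s ∈ X, ‖s‖ ≤ R → ∃ i : Fin (φ j), dist (x (φ j) i + τ j) s ≤ ε) ∧
      (∀ i : Fin (φ j), ‖x (φ j) i + τ j‖ ≤ R → ∃ s ∈ X, dist (x (φ j) i + τ j) s ≤ ε)) →
    (∃ a : ℝ, 47 / 50 ≤ a ∧ a ≤ 1 ∧ ∀ R η : ℝ, 0 < η →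
      ∃ (A : E3 →ₗᵢ[ℝ] E3) (t : E3) (s : ℤ → ℤ) (z : ℤ → ℝ), IsHaggSeq s ∧
        (∀ m : ℤ, 39 / 50 * a ≤ z (m + 1) - z m ∧ z (m + 1) - z m ≤ 17 / 20 * a) ∧
        let S : Set E3 := {p | ∃ m i j : ℤ, p = A (((i : ℝ) • triangularVec₁ a) +
          ((j : ℝ) • triangularVec₂ a) + ((haggLabel s m : ℝ) • barlowOffset a) + (z m • layerNormal 1))}
        (∀ p ∈ S, ‖p‖ ≤ R → ∃ q ∈ X, dist (q + t) p ≤ η) ∧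
        (∀ q ∈ X, ‖q + t‖ ≤ R → ∃ p ∈ S, dist (q + t) p ≤ η)) →
    ∃ a : ℝ, 47 / 50 ≤ a ∧ a ≤ 1 ∧ ∀ R ε : ℝ, 0 < ε → ∃ᶠ N in Filter.atTop,
      ∃ (A : E3 →ₗᵢ[ℝ] E3) (t : E3) (s : ℤ → ℤ) (z : ℤ → ℝ), IsHaggSeq s ∧
        (∀ m : ℤ, 39 / 50 * a ≤ z (m + 1) - z m ∧ z (m + 1) - z m ≤ 17 / 20 * a) ∧
        let S : Set E3 := {p | ∃ m i j : ℤ, p = A (((i : ℝ) • triangularVec₁ a) +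
          ((j : ℝ) • triangularVec₂ a) + ((haggLabel s m : ℝ) • barlowOffset a) + (z m • layerNormal 1))}
        (∀ p ∈ S, ‖p‖ ≤ R → ∃ i : Fin N, dist (x N i + t) p ≤ ε) ∧
        (∀ i : Fin N, ‖x N i + t‖ ≤ R → ∃ p ∈ S, dist (x N i + t) p ≤ ε) := by
  intro x X hhull hpatch
  obtain ⟨φ, hφ, τ, hlim⟩ := hhull
  obtain ⟨a, ha₁, ha₂, hpat⟩ := hpatch
  refine ⟨a, ha₁, ha₂, fun R ε hε => ?_⟩
  rw [Filter.frequently_atTop]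
  intro M
  have hε2 : 0 < ε / 2 := half_pos hε
  -- patch data at radius `R + ε/2`, tolerance `ε/2`
  obtain ⟨A, t, s, z, hs, hz, hP₁, hP₂⟩ := hpat (R + ε / 2) (ε / 2) hε2
  -- hull matching at radius `R + ‖t‖ + ε/2`, tolerance `ε/2`, at an index `j ≥ M`
  obtain ⟨j, hMj, hH₁, hH₂⟩ :=
    ((eventually_ge_atTop M).and (hlim (R + ‖t‖ + ε / 2) (ε / 2) hε2)).exists
  refine ⟨φ j, hMj.trans (hφ.id_le j), A, τ j + t, s, z, hs, hz, ?_, ?_⟩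
  · -- every template point of the window is near a particle
    intro p hp hpR
    obtain ⟨q, hqX, hq⟩ := hP₁ p hp (by linarith)
    have hqR : ‖q‖ ≤ R + ‖t‖ + ε / 2 := by
      have h₁ := norm_le_norm_add_norm_sub' (q + t) p
      rw [← dist_eq_norm] at h₁
      linarith [tr_norm_le_norm_add_add_norm q t]
    obtain ⟨i, hi⟩ := hH₁ q hqX hqR
    refine ⟨i, ?_⟩
    calc dist (x (φ j) i + (τ j + t)) p
        ≤ dist (x (φ j) i + (τ j + t)) (q + t) + dist (q + t) p := dist_triangle _ _ _
      _ = dist (x (φ j) i + τ j) q + dist (q + t) p := by rw [tr_dist_add_add]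
      _ ≤ ε / 2 + ε / 2 := add_le_add hi hq
      _ = ε := add_halves ε
  · -- every particle of the window is near a template point
    intro i hi
    have hiR : ‖x (φ j) i + τ j‖ ≤ R + ‖t‖ + ε / 2 := by
      have h₁ := tr_norm_le_norm_add_add_norm (x (φ j) i + τ j) t
      rw [add_assoc] at h₁
      linarith
    obtain ⟨w, hwX, hw⟩ := hH₂ i hiR
    have hwR : ‖w + t‖ ≤ R + ε / 2 := by
      have h₁ := norm_le_norm_add_norm_sub' (w + t) (x (φ j) i + (τ j + t))
      rw [← dist_eq_norm, dist_comm, tr_dist_add_add] at h₁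
      linarith
    obtain ⟨p, hpS, hp⟩ := hP₂ w hwX hwR
    refine ⟨p, hpS, ?_⟩
    calc dist (x (φ j) i + (τ j + t)) p
        ≤ dist (x (φ j) i + (τ j + t)) (w + t) + dist (w + t) p := dist_triangle _ _ _
      _ = dist (x (φ j) i + τ j) w + dist (w + t) p := by rw [tr_dist_add_add]
      _ ≤ ε / 2 + ε / 2 := add_le_add hw hp
      _ = ε := add_halves ε

end Summit.AtomisticToContinuum.Crystallization.Theorems.DisclinationRationBarlowLiouville

end
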